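import Summits.Parity.GeneralizedHardyLittlewood.Theorems.GreenTaoLevelTwoMNTwoFejerSmoothing

/-!
# Route `GreenTaoLevelTwo`, crux `MNTwo` (stmt-Parity-21276), line `birth`, stub `stub_mnVertical`:
# rotation Bohr sets in `ℤ` are large (GT 2008b Lemma 14 (a))

Brick for blocks V2–V6 of the `stub_mnVertical` census (B. Green, T. Tao, *Quadratic uniformity of the
Möbius function*, Ann. Inst. Fourier 58 (2008) = arXiv:math/0606087, §6 Def. 13 / Lemma 14 (a): for a
`1`-step nilsequence with rotation `g = α ∈ ℝᵏ` the "norm" `‖n‖_g = ‖gⁿ‖_{(ℝ/ℤ)ᵏ,∞} + |n|/N` and the Bohr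
sets `B_g(0,ρ) = {n ∈ ℤ : ‖n‖_g < ρ}` satisfy `|B_g(0,ρ)| ≫_k ρ^{O_k(1)} N` — "we cover `G/Γ` by
`O(ρ^{-O(1)})` balls of radius `ρ/4` and `{1,…,N}` into intervals of length `ρN/4`; by the pigeonhole
principle …").  Def-free, with the explicit constant `(ρ/16)^{k+1}/2`:

* `norm_coe_le_abs'` — `‖(t : ℝ/ℤ)‖ ≤ |t|`;
* `card_rotationBohr_ge` — `(ρ/16)^{k+1} N / 2 ≤ #{n ∈ (−N,N) : maxᵢ ‖nαᵢ‖_{ℝ/ℤ} + |n|/N < ρ}`.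

References: [GreenTao2008QuadraticMobius] arXiv:math/0606087 §6, Definition 13 and Lemma 14 (a).
-/

noncomputable section

open Finset Real

namespace Summit.Parity.GeneralizedHardyLittlewood.GreenTaoLevelTwoMNTwoRotationBohrSize

/-- `‖(t : ℝ/ℤ)‖ ≤ |t|`. [folklore] -/
theorem norm_coe_le_abs' (t : ℝ) : ‖((t : ℝ) : AddCircle (1 : ℝ))‖ ≤ |t| := by
  rw [AddCircle.norm_eq]
  have h := round_le (1⁻¹ * t) 0
  simp only [Int.cast_zero, sub_zero, one_mul, inv_one, mul_one] at h ⊢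
  exact h

/-- Two reals in the same cell of mesh `1/L` are `1/L`-close: if `⌊uL⌋₊ = ⌊vL⌋₊` with `0 ≤ u, v` then
`|u − v| < 1/L`. [folklore] -/
theorem abs_sub_lt_of_floor_eq {u v L : ℝ} (hL : 0 < L) (hu : 0 ≤ u) (hv : 0 ≤ v)
    (h : ⌊u * L⌋₊ = ⌊v * L⌋₊) : |u - v| < 1 / L := by
  have hu1 := Nat.floor_le (mul_nonneg hu hL.le)
  have hu2 := Nat.lt_floor_add_one (u * L)
  have hv1 := Nat.floor_le (mul_nonneg hv hL.le)
  have hv2 := Nat.lt_floor_add_one (v * L)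
  rw [h] at hu1 hu2
  rw [abs_sub_lt_iff, lt_div_iff₀ hL, lt_div_iff₀ hL]
  constructor <;> nlinarith

set_option maxHeartbeats 400000 in
/-- **Rotation Bohr sets are large (GT 2008b Lemma 14 (a)).**  For `N ≥ 1`, `α ∈ ℝᵏ` and `0 < ρ ≤ 1`:
`(ρ/16)^{k+1} N / 2 ≤ #{n ∈ ℤ, |n| < N : (∀ i, ‖nαᵢ‖_{ℝ/ℤ} + |n|/N < ρ) ∧ |n|/N < ρ}`.
[cite: GreenTao2008QuadraticMobius, Lemma 14 (a)] -/
theorem card_rotationBohr_ge (k : ℕ) {N : ℕ} (hN : 1 ≤ N) (α : Fin k → ℝ) {ρ : ℝ} (hρ : 0 < ρ)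
    (hρ1 : ρ ≤ 1) :
    (ρ / 16) ^ (k + 1) * N / 2 ≤
      #((Finset.Ioo (-(N : ℤ)) N).filter fun n : ℤ =>
        (∀ i, ‖(((n : ℝ) * α i : ℝ) : AddCircle (1 : ℝ))‖ + |(n : ℝ)| / N < ρ) ∧ |(n : ℝ)| / N < ρ) := by
  classical
  have hNpos : (0 : ℝ) < N := by exact_mod_cast hN
  set B := (Finset.Ioo (-(N : ℤ)) N).filter fun n : ℤ =>
    (∀ i, ‖(((n : ℝ) * α i : ℝ) : AddCircle (1 : ℝ))‖ + |(n : ℝ)| / N < ρ) ∧ |(n : ℝ)| / N < ρ with hB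
  -- `0 ∈ B`
  have h0B : (0 : ℤ) ∈ B := by
    rw [hB, mem_filter, mem_Ioo]
    refine ⟨⟨by omega, by omega⟩, fun i => ?_, by simp [hρ]⟩
    simp [hρ]
  have hB1 : (1 : ℝ) ≤ #B := by exact_mod_cast card_pos.2 ⟨0, h0B⟩
  by_cases hcase : (ρ / 16) ^ (k + 1) * N / 2 ≤ 1
  · exact hcase.trans hB1
  push Not at hcase
  -- Case `N` large: `N > 2 (16/ρ)^{k+1} ≥ 32/ρ`
  have hρ16 : ρ / 16 ≤ 1 := by linarith
  have hpow_le : (ρ / 16) ^ (k + 1) ≤ ρ / 16 := by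
    calc (ρ / 16) ^ (k + 1) = (ρ / 16) ^ k * (ρ / 16) := pow_succ _ _
      _ ≤ 1 * (ρ / 16) := mul_le_mul_of_nonneg_right (pow_le_one₀ (by positivity) hρ16) (by positivity)
      _ = ρ / 16 := one_mul _
  have hNbig : 32 / ρ < N := by
    have h1 : 1 < ρ / 16 * N / 2 := hcase.trans_le (by
      rw [div_le_div_iff_of_pos_right two_pos]; exact mul_le_mul_of_nonneg_right hpow_le hNpos.le)
    rw [div_lt_iff₀ hρ]; nlinarith
  have hinvN : 1 / (N : ℝ) < ρ / 32 := by
    rw [div_lt_iff₀ hNpos]; rw [div_lt_iff₀ hρ] at hNbig; linarith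
  have hN2 : (2 : ℝ) ≤ N := by
    have : (32 : ℝ) ≤ 32 / ρ := by rw [le_div_iff₀ hρ]; nlinarith
    linarith
  -- the cells
  set L : ℕ := ⌈8 / ρ⌉₊ with hL
  have hLpos : (0 : ℝ) < L := by
    rw [hL]; exact_mod_cast Nat.ceil_pos.2 (by positivity)
  have hLge : 8 / ρ ≤ (L : ℝ) := by rw [hL]; exact Nat.le_ceil _
  have hLle : (L : ℝ) ≤ 9 / ρ := by
    rw [hL]
    have h1 := Nat.ceil_lt_add_one (show (0 : ℝ) ≤ 8 / ρ by positivity)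
    have h2 : (1 : ℝ) ≤ 1 / ρ := by rw [le_div_iff₀ hρ]; linarith
    have : (8 : ℝ) / ρ + 1 ≤ 9 / ρ := by
      rw [show (9 : ℝ) / ρ = 8 / ρ + 1 / ρ by ring]; linarith
    linarith
  have hinvL : 1 / (L : ℝ) ≤ ρ / 8 := by
    rw [div_le_iff₀ hLpos]; rw [div_le_iff₀ hρ] at hLge; linarith
  set D : ℕ := ⌊ρ * N / 8⌋₊ + 1 with hD
  have hDpos : 0 < D := Nat.succ_pos _
  have hDposr : (0 : ℝ) < D := by exact_mod_cast hDpos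
  have hDle : (D : ℝ) ≤ ρ * N / 8 + 1 := by
    rw [hD]; push_cast; linarith [Nat.floor_le (show 0 ≤ ρ * N / 8 by positivity)]
  have hDge : ρ * N / 8 < D := by rw [hD]; push_cast; exact Nat.lt_floor_add_one _
  -- the cell map on `s = range N`
  set f : ℕ → (Fin k → ℕ) × ℕ := fun n =>
    (fun i => ⌊Int.fract ((n : ℝ) * α i) * L⌋₊, n / D) with hf
  set t : Finset ((Fin k → ℕ) × ℕ) := (Fintype.piFinset fun _ : Fin k => range L) ×ˢ range (N / D + 1)
    with ht
  have hmaps : ∀ n ∈ range N, f n ∈ t := by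
    intro n hn
    rw [mem_range] at hn
    rw [ht, mem_product, Fintype.mem_piFinset]
    refine ⟨fun i => ?_, ?_⟩
    · rw [mem_range]
      have h1 : Int.fract ((n : ℝ) * α i) * L < L := by
        calc Int.fract ((n : ℝ) * α i) * L < 1 * L :=
              mul_lt_mul_of_pos_right (Int.fract_lt_one _) hLpos
          _ = L := one_mul _
      have h0 : 0 ≤ Int.fract ((n : ℝ) * α i) * L := mul_nonneg (Int.fract_nonneg _) hLpos.le
      exact_mod_cast (Nat.floor_lt h0).2 h1
    · rw [mem_range]
      exact Nat.lt_succ_of_le (Nat.div_le_div_right hn.le)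
  -- the pigeonhole
  have hcardt : (#t : ℝ) ≤ (9 / ρ) ^ (k + 1) := by
    rw [ht, card_product, Fintype.card_piFinset, prod_const, card_univ, Fintype.card_fin, card_range,
      card_range]
    push_cast
    have h1 : ((N / D : ℕ) : ℝ) + 1 ≤ 9 / ρ := by
      have h2 : ((N / D : ℕ) : ℝ) ≤ (N : ℝ) / D := Nat.cast_div_le
      have h3 : (N : ℝ) / D ≤ 8 / ρ := by
        rw [div_le_div_iff₀ hDposr hρ]; nlinarith
      have h4 : (1 : ℝ) ≤ 1 / ρ := by rw [le_div_iff₀ hρ]; linarith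
      have : (8 : ℝ) / ρ + 1 ≤ 9 / ρ := by rw [show (9 : ℝ) / ρ = 8 / ρ + 1 / ρ by ring]; linarith
      linarith
    calc (L : ℝ) ^ k * (((N / D : ℕ) : ℝ) + 1) ≤ (9 / ρ) ^ k * (9 / ρ) := by gcongr
      _ = (9 / ρ) ^ (k + 1) := (pow_succ _ _).symm
  have htpos : 0 < #t := card_pos.2 ⟨f 0, hmaps 0 (mem_range.2 (by omega))⟩
  set m : ℕ := (N - 1) / #t with hm
  have hmul : #t * m < #(range N) := by
    rw [card_range, hm]
    calc #t * ((N - 1) / #t) ≤ N - 1 := by rw [mul_comm]; exact Nat.div_mul_le_self _ _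
      _ < N := by omega
  obtain ⟨y, -, hfib⟩ := Finset.exists_lt_card_fiber_of_mul_lt_card_of_maps_to hmaps hmul
  set S : Finset ℕ := (range N).filter fun n => f n = y with hS
  have hSm : m < #S := hfib
  have hSne : S.Nonempty := card_pos.1 (lt_of_le_of_lt (Nat.zero_le m) hSm)
  obtain ⟨n₀, hn₀⟩ := hSne
  have hmemS : ∀ {n}, n ∈ S → n < N ∧ f n = y := fun hn => by
    rw [hS, mem_filter, mem_range] at hn; exact hn
  -- `S - n₀ ⊆ B`
  have hsub : ∀ n ∈ S, ((n : ℤ) - n₀) ∈ B := by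
    intro n hn
    obtain ⟨hnN, hfn⟩ := hmemS hn
    obtain ⟨hn₀N, hfn₀⟩ := hmemS hn₀
    have hff : f n = f n₀ := hfn.trans hfn₀.symm
    rw [hf] at hff
    simp only [Prod.mk.injEq] at hff
    obtain ⟨hcells, hint⟩ := hff
    -- the interval part: `|n - n₀| < D`
    obtain ⟨q, hq⟩ : ∃ q, n / D = q := ⟨_, rfl⟩
    have e1 : n = D * q + n % D := by rw [← hq]; exact (Nat.div_add_mod n D).symm
    have e2 : n₀ = D * q + n₀ % D := by rw [← hq, hint]; exact (Nat.div_add_mod n₀ D).symm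
    have e1r : (n : ℝ) = (D : ℝ) * q + ((n % D : ℕ) : ℝ) := by exact_mod_cast e1
    have e2r : (n₀ : ℝ) = (D : ℝ) * q + ((n₀ % D : ℕ) : ℝ) := by exact_mod_cast e2
    have hr : ((n % D : ℕ) : ℝ) < D := by exact_mod_cast Nat.mod_lt n hDpos
    have hr₀ : ((n₀ % D : ℕ) : ℝ) < D := by exact_mod_cast Nat.mod_lt n₀ hDpos
    have hr0 : (0 : ℝ) ≤ ((n % D : ℕ) : ℝ) := Nat.cast_nonneg _
    have hr₀0 : (0 : ℝ) ≤ ((n₀ % D : ℕ) : ℝ) := Nat.cast_nonneg _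
    have hdiff : |(n : ℝ) - n₀| < D := by
      rw [abs_sub_lt_iff]; constructor <;> linarith
    have hratio : |(n : ℝ) - n₀| / N < ρ / 8 + ρ / 32 := by
      rw [div_lt_iff₀ hNpos]
      have h2 : (1 : ℝ) < ρ / 32 * N := by
        rw [div_lt_iff₀ hNpos] at hinvN; linarith
      nlinarith
    -- the torus part
    have htor : ∀ i, ‖((((n : ℝ) - n₀) * α i : ℝ) : AddCircle (1 : ℝ))‖ < ρ / 8 := by
      intro i
      have hc : ⌊Int.fract ((n : ℝ) * α i) * L⌋₊ = ⌊Int.fract ((n₀ : ℝ) * α i) * L⌋₊ := congrFun hcells i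
      have hclose := abs_sub_lt_of_floor_eq hLpos (Int.fract_nonneg _) (Int.fract_nonneg _) hc
      have e : ((((n : ℝ) - n₀) * α i : ℝ) : AddCircle (1 : ℝ)) =
          ((Int.fract ((n : ℝ) * α i) - Int.fract ((n₀ : ℝ) * α i) : ℝ) : AddCircle (1 : ℝ)) := by
        rw [← sub_eq_zero, ← AddCircle.coe_sub, AddCircle.coe_eq_zero_iff]
        refine ⟨⌊(n : ℝ) * α i⌋ - ⌊(n₀ : ℝ) * α i⌋, ?_⟩
        rw [← Int.self_sub_floor, ← Int.self_sub_floor, zsmul_eq_mul, mul_one]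
        push_cast
        ring
      rw [e]
      calc ‖((Int.fract ((n : ℝ) * α i) - Int.fract ((n₀ : ℝ) * α i) : ℝ) : AddCircle (1 : ℝ))‖
          ≤ |Int.fract ((n : ℝ) * α i) - Int.fract ((n₀ : ℝ) * α i)| := norm_coe_le_abs' _
        _ < 1 / L := hclose
        _ ≤ ρ / 8 := hinvL
    rw [hB, mem_filter, mem_Ioo]
    have hnI : (-(N : ℤ)) < (n : ℤ) - n₀ ∧ (n : ℤ) - n₀ < N := by omega
    refine ⟨hnI, fun i => ?_, ?_⟩
    · have := htor i
      push_cast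
      linarith
    · push_cast
      linarith
  -- count
  have hinj : Set.InjOn (fun n : ℕ => (n : ℤ) - n₀) S := by
    intro a _ b _ h
    have h' : (a : ℤ) = b := by simpa using h
    exact_mod_cast h'
  have hcardS : #S ≤ #B := by
    rw [← card_image_of_injOn hinj]
    exact card_le_card fun z hz => by
      obtain ⟨n, hn, rfl⟩ := mem_image.1 hz
      exact hsub n hn
  have hcardSr : (#S : ℝ) ≤ #B := by exact_mod_cast hcardS
  have htposr : (0 : ℝ) < #t := by exact_mod_cast htpos
  -- marker1
  have hm1 : ((N : ℝ) - 1) < ((m : ℝ) + 1) * #t := by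
    have h2 : N - 1 < (N - 1) / #t * #t + #t := Nat.lt_div_mul_add htpos
    have h3 : ((N - 1 : ℕ) : ℝ) < ((((N - 1) / #t : ℕ) : ℝ) * #t + #t) := by exact_mod_cast h2
    rw [Nat.cast_sub hN, Nat.cast_one, ← hm] at h3
    linarith
  have hSm1 : ((m : ℝ) + 1) ≤ #S := by exact_mod_cast hSm
  have hSreal : ((N : ℝ) - 1) / #t ≤ #S := by
    rw [div_le_iff₀ htposr]
    calc (N : ℝ) - 1 ≤ ((m : ℝ) + 1) * #t := hm1.le
      _ ≤ #S * #t := mul_le_mul_of_nonneg_right hSm1 htposr.le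
  -- marker2
  have hpow9 : (ρ / 16) ^ (k + 1) ≤ (ρ / 9) ^ (k + 1) := by
    apply pow_le_pow_left₀ (by positivity)
    rw [div_le_div_iff₀ (by norm_num) (by norm_num)]
    nlinarith
  have hprod : (ρ / 9) ^ (k + 1) * (#t : ℝ) ≤ 1 := by
    calc (ρ / 9) ^ (k + 1) * (#t : ℝ) ≤ (ρ / 9) ^ (k + 1) * (9 / ρ) ^ (k + 1) :=
          mul_le_mul_of_nonneg_left hcardt (by positivity)
      _ = ((ρ / 9) * (9 / ρ)) ^ (k + 1) := (mul_pow _ _ _).symm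
      _ = 1 := by
          have e : (ρ / 9) * (9 / ρ) = 1 := by field_simp
          rw [e, one_pow]
  -- marker3
  have hN1 : (0 : ℝ) ≤ (N : ℝ) - 1 := by linarith
  have ecanc : (#t : ℝ) * (((N : ℝ) - 1) / #t) = (N : ℝ) - 1 := by
    rw [mul_comm]; exact div_mul_cancel₀ _ htposr.ne'
  calc (ρ / 16) ^ (k + 1) * N / 2 = (ρ / 16) ^ (k + 1) * (N / 2) := by ring
    _ ≤ (ρ / 9) ^ (k + 1) * ((N : ℝ) - 1) := mul_le_mul hpow9 (by linarith) (by positivity) (by positivity)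
    _ = (ρ / 9) ^ (k + 1) * (#t : ℝ) * (((N : ℝ) - 1) / #t) := by rw [mul_assoc, ecanc]
    _ ≤ 1 * (((N : ℝ) - 1) / #t) := mul_le_mul_of_nonneg_right hprod (div_nonneg hN1 htposr.le)
    _ = ((N : ℝ) - 1) / #t := one_mul _
    _ ≤ #S := hSreal
    _ ≤ #B := hcardSr

end Summit.Parity.GeneralizedHardyLittlewood.GreenTaoLevelTwoMNTwoRotationBohrSize
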